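import Mathlib
import Summits.ValiantsHypothesis.ValiantsHypothesis.Theorems.SymPencilEquivariantSdcNotQPFiniteConjugationLift
import Summits.ValiantsHypothesis.ValiantsHypothesis.Theorems.SymPencilEquivariantSdcNotQPPermifyExponentialOfLift
import HarnessLib

/-!
# ValiantsHypothesis / SymPencil — crux `EquivariantSdcNotQP` (stmt-ValiantsHypothesis-17792),
# line `birth_EquivariantSdcNotQP`: `stub_permify` at EXPONENTIAL cost, unconditionally (helper)

`permify_exponential` = `permify_exponential_of_finiteLift finiteConjugationLift`: every
`Γ_n`-equivariant affine determinantal representation of `per_n` of size `m` (LINEAR lifts of the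
row/column permutation pairs) yields an affine pencil of size `m' ≤ m² · (n!)²` with `det = per_n`
on which every substitution `x_{ij} ↦ x_{π i, ρ j}` acts by conjugation with a PERMUTATION matrix
— the conclusion of the registered stub `stub_permify` with its quasi-polynomial budget replaced
by `m² (n!)²` (and without its unused symmetry hypothesis).  So the open content of `stub_permify`
is exactly the BUDGET, i.e. piece (iii′) `PermEmbeddingQP` in the small-pencil regime
(`…PermEmbeddingRegular.lean :: permEmbeddingQP_of_large` covers `log₂ m₀ ≳ √(2 n log₂ n)`;
plan: `Cruxes/EquivariantSdcNotQP/PLAN-PermEmbeddingQP.md`).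

Honest framing: `stub_permify`, the crux `EquivariantSdcNotQP` and `VP ≠ VNP` remain OPEN; an
exponential-size symmetric model carries no lower-bound transfer.  Helper file
(`--supports stmt-ValiantsHypothesis-17792 --as helper`); 0 definitions, 0 named facts.
-/

noncomputable section

set_option linter.dupNamespace false

namespace Summit.ValiantsHypothesis.ValiantsHypothesis.Theorems.SymPencilEquivariantSdcNotQP

open Matrix MvPolynomial Literature.Computability.AlgebraicComplexity

/-- **`stub_permify` at exponential cost, unconditionally** (`permify_exponential_of_finiteLift`
fed with the tree theorem `finiteConjugationLift` = piece (ii′)): a `Γ_n`-equivariant affine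
determinantal representation of `per_n` of size `m` yields an affine pencil of size
`m' ≤ m² · (n!)²` with `det = per_n` whose substitutions `x_{ij} ↦ x_{π i, ρ j}` are undone by
conjugation with PERMUTATION matrices.  Honest framing: the quasi-polynomial budget (piece (iii′))
is the open content of `stub_permify`; the crux and `VP ≠ VNP` remain OPEN. [folklore] -/
theorem permify_exponential (n m : ℕ) (A : Matrix (Fin m) (Fin m) (MvPolynomial (Fin n × Fin n) ℂ))
    (hA : IsEquivariantDetRepr (Subgroup.closure {γ : GL (Fin n × Fin n) ℂ |
        ∃ π ρ : Equiv.Perm (Fin n), (γ : Matrix (Fin n × Fin n) (Fin n × Fin n) ℂ) =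
          Equiv.Perm.permMatrix ℂ (Equiv.prodCongr π ρ)}) (perPoly (Fin n) ℂ) A) :
    ∃ m' ≤ m ^ 2 * (Nat.factorial n) ^ 2,
      ∃ A' : Matrix (Fin m') (Fin m') (MvPolynomial (Fin n × Fin n) ℂ),
        IsAffineDetRepr (perPoly (Fin n) ℂ) A' ∧
        ∀ π ρ : Equiv.Perm (Fin n), ∃ σ : Equiv.Perm (Fin m'),
          A'.map (MvPolynomial.rename fun ij : Fin n × Fin n => (π ij.1, ρ ij.2)) =
            (σ.permMatrix ℂ).map MvPolynomial.C * A' * ((σ.permMatrix ℂ)ᵀ).map MvPolynomial.C :=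
  permify_exponential_of_finiteLift finiteConjugationLift n m A hA

end Summit.ValiantsHypothesis.ValiantsHypothesis.Theorems.SymPencilEquivariantSdcNotQP

end
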